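import Literature.IUT.LogVolume.Corollary22QParamBaseChange
import Literature.NumberTheory.DiophantineGeometry.GenEllProjLine
import Mathlib.NumberTheory.Cyclotomic.Gal
import Mathlib.NumberTheory.Cyclotomic.PrimitiveRoots
import Mathlib.NumberTheory.NumberField.Norm
import Mathlib.RingTheory.Ideal.Norm.AbsNorm
import HarnessLib

/-!
# The Gaussian twist points `λ_{a,b} = ζ₄(a+bζ₄)/(a−bζ₄)` of the `λ`-line over `ℚ(ζ₄)` — the objects

Record file (D-0012) of the abc-iut cell, block E (rung LADDER-ABC:A2.E; seat abc-iut-E-t28, slot T-28 = [J-IV] §5.4–5.7,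
authors-first companion chain deciding the literal @[claim] `ATS4.Thm571` of the LANDED row J4:Thm5.7.1). TAKES NO SIDE on
[IUTchIII] Cor. 3.12, on the claims of K. Joshi, or on S. Mochizuki's reports on them; CLASSICAL arithmetic of `ℚ(√−1)`,
kernel-checked; typed ≠ proved; NO abc claim. No `Cor312*`/`Thm311*` import (E-PLAN R14).

WHAT IS HERE (every DEFINITION of the chain `ATS4LegendreThetaFieldNonGalois` ← this file ← `ATS4GaussianTwistPrime`,
`ATS4GaussianTwistAnnulus` ← `ATS4Thm571LiteralRefutation`; the sequels are proof-only). §1 the Gaussian field `K4 = ℚ(ζ₄)` as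
Mathlib's `CyclotomicField 4 ℚ`: `zeta4` (`ζ₄² = −1`), `[K4:ℚ] = 2`, complex conjugation `conjK4 = σ₀ : ζ₄ ↦ −ζ₄`
(`IsCyclotomicExtension.fromZetaAut`), `Gal(K4/ℚ) = {1, σ₀}`, hence `N(x) = x·σ₀x`, `Tr(x) = x + σ₀x`. §2 for `a b : ℕ`:
`α = a + bζ₄`, `ᾱ = a − bζ₄`, **`lam a b = λ_{a,b} := ζ₄·α²/(a²+b²)`** (`= ζ₄α/ᾱ`, `lam_eq_div`); `σ₀λ = λ⁻¹` (`conjK4_lam`: norm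
`1`, which makes `j(λ) = j(1/λ)` rational); `λ ≠ 0, 1`; `λ + λ⁻¹ = t := −4ab/(a²+b²)` (`traceLam`, `lam_add_inv`, `trace_lam`);
`j(λ) = 2⁸(t−1)³/(t−2) = jLam a b ∈ ℚ` (`jInv_lam`); elementary facts on primes `p = a² + b²`. §3a the algebraic integers `ζ₄`,
`α`, `ᾱ ∈ 𝓞 K4`, `N(α) = a² + b²` (`norm_alphaInt`), and for `p` prime the place **`primeV hp = (α)`** (prime: its norm is `p`,
`Ideal.isPrime_of_irreducible_absNorm`). §4a the presented point **`gaussPoint a b = (K4, λ_{a,b}) : NFPoint`**.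
Definitions + proved lemmas only; no claim is typed here. [folklore]
-/

noncomputable section

open scoped Classical

open NumberField IsDedekindDomain IsCyclotomicExtension Polynomial
open Literature.IUT.LogVolume Literature.IUT.LogVolume.Cor22
open Literature.NumberTheory.DiophantineGeometry.GenEll

namespace Summit.ABC.IUTFork.Joshi.ATS4

/-! ## 1. The Gaussian field `ℚ(ζ₄)` -/

/-- The Gaussian field `ℚ(√−1)`, as the `4`-th cyclotomic field over `ℚ` (Mathlib `CyclotomicField 4 ℚ`). [folklore] -/
abbrev K4 : Type := CyclotomicField 4 ℚ

/-- `ℚ(ζ₄)/ℚ` is a `4`-th cyclotomic extension (Mathlib's instance, made explicit). [folklore] -/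
theorem isCyclotomicExtension_K4 : IsCyclotomicExtension {4} ℚ K4 := CyclotomicField.isCyclotomicExtension 4 ℚ

/-- `ζ = ζ₄ = √−1`, the distinguished primitive `4`-th root of unity of `ℚ(ζ₄)`. [folklore] -/
def zeta4 : K4 :=
  haveI := isCyclotomicExtension_K4
  IsCyclotomicExtension.zeta 4 ℚ K4

/-- `ζ₄` is a primitive `4`-th root of unity. [folklore] -/
theorem zeta4_isPrimitiveRoot : IsPrimitiveRoot zeta4 4 := by
  haveI := isCyclotomicExtension_K4
  unfold zeta4
  exact IsCyclotomicExtension.zeta_spec 4 ℚ K4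

/-- `ζ₄² = −1`. [folklore] -/
theorem zeta4_sq : zeta4 ^ 2 = -1 := by
  have h := zeta4_isPrimitiveRoot
  have h4 : zeta4 ^ 4 = 1 := h.pow_eq_one
  have h2 : zeta4 ^ 2 ≠ 1 := h.pow_ne_one_of_pos_of_lt (by norm_num) (by norm_num)
  have : (zeta4 ^ 2 - 1) * (zeta4 ^ 2 + 1) = 0 := by ring_nf; rw [h4]; ring
  rcases mul_eq_zero.1 this with h0 | h0
  · exact absurd (sub_eq_zero.1 h0) h2
  · linear_combination h0

/-- `ζ₄ ≠ 0`. [folklore] -/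
theorem zeta4_ne_zero : zeta4 ≠ 0 := zeta4_isPrimitiveRoot.ne_zero (by norm_num)

/-- `[ℚ(ζ₄) : ℚ] = φ(4) = 2`. [folklore] -/
theorem finrank_K4 : Module.finrank ℚ K4 = 2 := by
  haveI := isCyclotomicExtension_K4
  rw [IsCyclotomicExtension.finrank (n := 4) K4 (cyclotomic.irreducible_rat (by norm_num))]
  decide

/-- Complex conjugation `σ₀ : ζ₄ ↦ ζ₄⁻¹ = −ζ₄`, the nontrivial `ℚ`-automorphism of `ℚ(ζ₄)`. [folklore] -/
def conjK4 : K4 ≃ₐ[ℚ] K4 :=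
  haveI := isCyclotomicExtension_K4
  IsCyclotomicExtension.fromZetaAut zeta4_isPrimitiveRoot.inv (cyclotomic.irreducible_rat (by norm_num))

/-- `ζ₄⁻¹ = −ζ₄`. [folklore] -/
theorem zeta4_inv : zeta4⁻¹ = -zeta4 :=
  inv_eq_of_mul_eq_one_right (by linear_combination -zeta4_sq)

/-- `σ₀(ζ₄) = −ζ₄`. [folklore] -/
theorem conjK4_zeta4 : conjK4 zeta4 = -zeta4 := by
  haveI := isCyclotomicExtension_K4
  have h : conjK4 (IsCyclotomicExtension.zeta 4 ℚ K4) = zeta4⁻¹ := by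
    unfold conjK4
    exact IsCyclotomicExtension.fromZetaAut_spec zeta4_isPrimitiveRoot.inv (cyclotomic.irreducible_rat (by norm_num))
  rw [← zeta4_inv]
  exact h

/-- `σ₀ ≠ 1`. [folklore] -/
theorem conjK4_ne_one : conjK4 ≠ 1 := by
  intro h
  have h1 : conjK4 zeta4 = zeta4 := by rw [h]; rfl
  rw [conjK4_zeta4] at h1
  have : (2 : K4) * zeta4 = 0 := by linear_combination -h1
  exact zeta4_ne_zero (by simpa using this)

/-- `Gal(ℚ(ζ₄)/ℚ) = {1, σ₀}`. [folklore] -/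
theorem univ_aut_K4 : (Finset.univ : Finset (K4 ≃ₐ[ℚ] K4)) = {1, conjK4} := by
  haveI := isCyclotomicExtension_K4
  haveI : IsGalois ℚ K4 := IsCyclotomicExtension.isGalois {4} ℚ K4
  symm
  apply Finset.eq_univ_of_card
  rw [Finset.card_pair (Ne.symm conjK4_ne_one), ← Nat.card_eq_fintype_card, IsGalois.card_aut_eq_finrank, finrank_K4]

/-- `N_{ℚ(ζ₄)/ℚ}(x) = x·σ₀(x)`. [folklore] -/
theorem algebraMap_norm_K4 (x : K4) : algebraMap ℚ K4 (Algebra.norm ℚ x) = x * conjK4 x := by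
  haveI := isCyclotomicExtension_K4
  haveI : IsGalois ℚ K4 := IsCyclotomicExtension.isGalois {4} ℚ K4
  rw [Algebra.norm_eq_prod_automorphisms, univ_aut_K4, Finset.prod_pair (Ne.symm conjK4_ne_one)]
  rfl

/-- `Tr_{ℚ(ζ₄)/ℚ}(x) = x + σ₀(x)`. [folklore] -/
theorem algebraMap_trace_K4 (x : K4) : algebraMap ℚ K4 (Algebra.trace ℚ K4 x) = x + conjK4 x := by
  haveI := isCyclotomicExtension_K4
  haveI : IsGalois ℚ K4 := IsCyclotomicExtension.isGalois {4} ℚ K4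
  rw [trace_eq_sum_automorphisms, univ_aut_K4, Finset.sum_pair (Ne.symm conjK4_ne_one)]
  rfl

/-! ## 2. The points `λ_{a,b} = ζ(a+bζ)/(a−bζ) = ζ(a+bζ)²/(a²+b²)` -/

section Lambda

variable (a b : ℕ)

/-- `α = a + bζ₄`. [folklore] -/
def alphaK : K4 := (a : K4) + (b : K4) * zeta4

/-- `ᾱ = a − bζ₄ = σ₀(α)`. [folklore] -/
def alphaBar : K4 := (a : K4) - (b : K4) * zeta4

/-- `λ_{a,b} = ζ₄·(a + bζ₄)²/(a² + b²)` (`= ζ₄(a+bζ₄)/(a−bζ₄)`, a point of `U(ℚ(ζ₄))` of norm `1` down to `ℚ`). [folklore] -/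
def lam : K4 := zeta4 * alphaK a b ^ 2 / ((a ^ 2 + b ^ 2 : ℕ) : K4)

/-- `σ₀(α) = ᾱ`. [folklore] -/
theorem conjK4_alphaK : conjK4 (alphaK a b) = alphaBar a b := by
  simp [alphaK, alphaBar, map_add, map_mul, map_natCast, conjK4_zeta4, sub_eq_add_neg]

/-- `σ₀(ᾱ) = α`. [folklore] -/
theorem conjK4_alphaBar : conjK4 (alphaBar a b) = alphaK a b := by
  simp [alphaK, alphaBar, map_sub, map_mul, map_natCast, conjK4_zeta4]

/-- `α·ᾱ = a² + b²`. [folklore] -/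
theorem alphaK_mul_alphaBar : alphaK a b * alphaBar a b = ((a ^ 2 + b ^ 2 : ℕ) : K4) := by
  simp only [alphaK, alphaBar]
  push_cast
  linear_combination (-(b : K4) ^ 2) * zeta4_sq

/-- `α² − ᾱ² = 4abζ₄`. [folklore] -/
theorem alphaK_sq_sub_alphaBar_sq : alphaK a b ^ 2 - alphaBar a b ^ 2 = 4 * (a : K4) * b * zeta4 := by
  simp only [alphaK, alphaBar]
  ring

variable {a b}

/-- `ᾱ ≠ 0` as soon as `a² + b² ≠ 0`. [folklore] -/
theorem alphaBar_ne_zero (h : a ^ 2 + b ^ 2 ≠ 0) : alphaBar a b ≠ 0 := by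
  intro h0
  have h1 := alphaK_mul_alphaBar a b
  rw [h0, mul_zero] at h1
  exact h (by exact_mod_cast h1.symm)

/-- `α ≠ 0` as soon as `a² + b² ≠ 0`. [folklore] -/
theorem alphaK_ne_zero (h : a ^ 2 + b ^ 2 ≠ 0) : alphaK a b ≠ 0 := by
  intro h0
  have h1 := alphaK_mul_alphaBar a b
  rw [h0, zero_mul] at h1
  exact h (by exact_mod_cast h1.symm)

/-- `λ = ζ₄·α/ᾱ`. [folklore] -/
theorem lam_eq_div (h : a ^ 2 + b ^ 2 ≠ 0) : lam a b = zeta4 * alphaK a b / alphaBar a b := by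
  have hᾱ := alphaBar_ne_zero h
  have hp : ((a ^ 2 + b ^ 2 : ℕ) : K4) ≠ 0 := by exact_mod_cast h
  rw [lam, div_eq_div_iff hp hᾱ, ← alphaK_mul_alphaBar]
  ring

/-- `λ ≠ 0`. [folklore] -/
theorem lam_ne_zero (h : a ^ 2 + b ^ 2 ≠ 0) : lam a b ≠ 0 := by
  have hp : ((a ^ 2 + b ^ 2 : ℕ) : K4) ≠ 0 := by exact_mod_cast h
  exact div_ne_zero (mul_ne_zero zeta4_ne_zero (pow_ne_zero 2 (alphaK_ne_zero h))) hp

/-- `λ·σ₀(λ) = 1` (the norm of `λ` down to `ℚ` is `1`). [folklore] -/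
theorem lam_mul_conjK4_lam (h : a ^ 2 + b ^ 2 ≠ 0) : lam a b * conjK4 (lam a b) = 1 := by
  have hp : ((a ^ 2 + b ^ 2 : ℕ) : K4) ≠ 0 := by exact_mod_cast h
  simp only [lam, map_div₀, map_mul, map_pow, map_natCast, conjK4_zeta4, conjK4_alphaK]
  rw [div_mul_div_comm, div_eq_one_iff_eq (mul_ne_zero hp hp), ← alphaK_mul_alphaBar]
  linear_combination (-(alphaK a b * alphaBar a b) ^ 2) * zeta4_sq

/-- `σ₀(λ) = λ⁻¹`. [folklore] -/
theorem conjK4_lam (h : a ^ 2 + b ^ 2 ≠ 0) : conjK4 (lam a b) = (lam a b)⁻¹ :=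
  eq_inv_of_mul_eq_one_right (lam_mul_conjK4_lam h)

/-- `λ ≠ 1`: otherwise `ζα = ᾱ`, i.e. `(a+b)ζ₄ = a + b`. [folklore] -/
theorem lam_ne_one (h : a ^ 2 + b ^ 2 ≠ 0) (hab : a + b ≠ 0) : lam a b ≠ 1 := by
  intro h1
  have hᾱ := alphaBar_ne_zero h
  rw [lam_eq_div h, div_eq_one_iff_eq hᾱ, alphaK, alphaBar] at h1
  have hne : ((a + b : ℕ) : K4) ≠ 0 := by exact_mod_cast hab
  have h2 : ((a + b : ℕ) : K4) * zeta4 = ((a + b : ℕ) : K4) * 1 := by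
    push_cast
    linear_combination h1 - (b : K4) * zeta4_sq
  have hz : zeta4 = 1 := mul_left_cancel₀ hne h2
  have := zeta4_sq
  rw [hz] at this
  norm_num at this

/-- The rational number `t = λ + λ⁻¹ = −4ab/(a² + b²)` (the trace of `λ` down to `ℚ`). [folklore] -/
def traceLam (a b : ℕ) : ℚ := -(4 * a * b : ℚ) / (a ^ 2 + b ^ 2 : ℚ)

/-- `λ + λ⁻¹ = −4ab/(a² + b²)`. [folklore] -/
theorem lam_add_inv (h : a ^ 2 + b ^ 2 ≠ 0) : lam a b + (lam a b)⁻¹ = (traceLam a b : K4) := by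
  have hp : ((a ^ 2 + b ^ 2 : ℕ) : K4) ≠ 0 := by exact_mod_cast h
  rw [← conjK4_lam h]
  simp only [lam, traceLam, map_div₀, map_mul, map_pow, map_natCast, conjK4_zeta4, conjK4_alphaK]
  push_cast at hp ⊢
  rw [← add_div, div_eq_div_iff hp hp]
  have hsq := alphaK_sq_sub_alphaBar_sq a b
  linear_combination ((a : K4) ^ 2 + (b : K4) ^ 2) * zeta4 * hsq +
    (4 * (a : K4) * b * ((a : K4) ^ 2 + (b : K4) ^ 2)) * zeta4_sq

/-- `Tr_{ℚ(ζ₄)/ℚ}(λ) = −4ab/(a² + b²)`. [folklore] -/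
theorem trace_lam (h : a ^ 2 + b ^ 2 ≠ 0) : Algebra.trace ℚ K4 (lam a b) = traceLam a b := by
  apply (algebraMap ℚ K4).injective
  rw [algebraMap_trace_K4, conjK4_lam h, lam_add_inv h, eq_ratCast]

/-- `j(λ) = 2⁸(λ²−λ+1)³/(λ²(λ−1)²) = 2⁸(t−1)³/(t−2)` with `t = λ + λ⁻¹`, for `λ ≠ 0, 1`. [folklore] -/
theorem jInv_eq_of_add_inv {F : Type} [Field F] {x t : F} (hx : x ≠ 0) (hx1 : x ≠ 1) (ht : x + x⁻¹ = t) :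
    jInv x = 2 ^ 8 * (t - 1) ^ 3 / (t - 2) := by
  have h1 : x ^ 2 - x + 1 = x * (t - 1) := by rw [← ht]; field_simp; ring
  have h2 : x ^ 2 * (x - 1) ^ 2 = x ^ 3 * (t - 2) := by rw [← ht]; field_simp; ring
  have ht2 : t - 2 ≠ 0 := by
    intro h0
    have : x ^ 2 * (x - 1) ^ 2 = 0 := by rw [h2, h0, mul_zero]
    rcases mul_eq_zero.1 this with h | h
    · exact hx (pow_eq_zero_iff two_ne_zero |>.1 h)
    · exact hx1 (sub_eq_zero.1 (pow_eq_zero_iff two_ne_zero |>.1 h))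
  rw [jInv, h1, h2, mul_pow, div_eq_div_iff (mul_ne_zero (pow_ne_zero 3 hx) ht2) ht2]
  ring

/-- The rational number `j(λ_{a,b}) = 2⁸(t−1)³/(t−2)`, `t = −4ab/(a²+b²)`. [folklore] -/
def jLam (a b : ℕ) : ℚ := 2 ^ 8 * (traceLam a b - 1) ^ 3 / (traceLam a b - 2)

/-- `j(λ_{a,b}) ∈ ℚ`: `jInv λ = jLam a b`. [folklore] -/
theorem jInv_lam (h : a ^ 2 + b ^ 2 ≠ 0) (hab : a + b ≠ 0) : jInv (lam a b) = (jLam a b : K4) := by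
  rw [jInv_eq_of_add_inv (lam_ne_zero h) (lam_ne_one h hab) (lam_add_inv h), jLam]
  push_cast
  ring

end Lambda

/-! ## 2b. Elementary facts about primes `p = a² + b²` -/

section NatFacts

variable {a b : ℕ}

/-- From `p = a² + b²` prime: `a, b ≥ 1`, `a < p`. [folklore] -/
theorem pos_of_prime (hp : (a ^ 2 + b ^ 2).Prime) : 0 < a ∧ 0 < b := by
  constructor
  · rcases Nat.eq_zero_or_pos a with rfl | ha
    · simp only [ne_eq, OfNat.ofNat_ne_zero, not_false_eq_true, zero_pow, zero_add] at hp
      rw [sq, Nat.prime_mul_iff] at hp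
      rcases hp with ⟨h1, h2⟩ | ⟨h1, h2⟩ <;> exact absurd h2 h1.one_lt.ne'
    · exact ha
  · rcases Nat.eq_zero_or_pos b with rfl | hb
    · simp only [ne_eq, OfNat.ofNat_ne_zero, not_false_eq_true, zero_pow, add_zero] at hp
      rw [sq, Nat.prime_mul_iff] at hp
      rcases hp with ⟨h1, h2⟩ | ⟨h1, h2⟩ <;> exact absurd h2 h1.one_lt.ne'
    · exact hb

/-- From `p = a² + b²` prime and `p ≠ 2`: `a ≠ b` (else `p = 2a²`). [folklore] -/
theorem ne_of_prime (hp : (a ^ 2 + b ^ 2).Prime) (hp2 : a ^ 2 + b ^ 2 ≠ 2) : a ≠ b := by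
  rintro rfl
  have h2 : a ^ 2 + a ^ 2 = 2 * (a * a) := by ring
  rw [h2] at hp hp2
  rcases (Nat.prime_mul_iff.1 hp) with ⟨_, h⟩ | ⟨h, _⟩
  · rcases mul_eq_one.1 h with ⟨rfl, -⟩
    exact hp2 rfl
  · rcases (Nat.prime_mul_iff.1 h) with ⟨ha, ha1⟩ | ⟨ha, ha1⟩ <;> exact ha.one_lt.ne' ha1

/-- `a + b` is odd when `p = a² + b²` is an odd prime. [folklore] -/
theorem odd_add_of_prime (hp : (a ^ 2 + b ^ 2).Prime) (hp2 : a ^ 2 + b ^ 2 ≠ 2) : Odd (a + b) := by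
  have hodd : Odd (a ^ 2 + b ^ 2) := hp.odd_of_ne_two hp2
  rw [Nat.odd_add, Nat.odd_pow_iff two_ne_zero, Nat.even_pow' two_ne_zero] at hodd
  rw [Nat.odd_add]
  exact hodd

end NatFacts

/-! ## 3a. The algebraic integers `ζ₄, α, ᾱ` and the place `v = (α)` -/

section Integers

variable (a b : ℕ)

/-- `ζ₄` as an algebraic integer. [folklore] -/
def zetaInt : 𝓞 K4 := ⟨zeta4, zeta4_isPrimitiveRoot.isIntegral (by norm_num)⟩

/-- `α = a + bζ₄` as an algebraic integer. [folklore] -/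
def alphaInt : 𝓞 K4 := (a : 𝓞 K4) + (b : 𝓞 K4) * zetaInt

/-- `ᾱ = a − bζ₄` as an algebraic integer. [folklore] -/
def alphaBarInt : 𝓞 K4 := (a : 𝓞 K4) - (b : 𝓞 K4) * zetaInt

/-- `(ζInt : K) = ζ₄`. [folklore] -/
theorem coe_zetaInt : ((zetaInt : 𝓞 K4) : K4) = zeta4 := rfl

/-- `(αInt : K) = α`. [folklore] -/
theorem coe_alphaInt : ((alphaInt a b : 𝓞 K4) : K4) = alphaK a b := by
  simp [alphaInt, alphaK, coe_zetaInt]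

/-- `(ᾱInt : K) = ᾱ`. [folklore] -/
theorem coe_alphaBarInt : ((alphaBarInt a b : 𝓞 K4) : K4) = alphaBar a b := by
  simp [alphaBarInt, alphaBar, coe_zetaInt]

/-- `αInt·ᾱInt = a² + b²` in `ℤ[ζ₄]`. [folklore] -/
theorem alphaInt_mul_alphaBarInt : alphaInt a b * alphaBarInt a b = ((a ^ 2 + b ^ 2 : ℕ) : 𝓞 K4) := by
  apply RingOfIntegers.coe_injective
  simp only [map_mul, map_natCast]
  rw [show algebraMap (𝓞 K4) K4 (alphaInt a b) = alphaK a b from coe_alphaInt a b,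
    show algebraMap (𝓞 K4) K4 (alphaBarInt a b) = alphaBar a b from coe_alphaBarInt a b, alphaK_mul_alphaBar]

/-- `N_{ℚ(ζ₄)/ℚ}(α) = a² + b²` on `ℤ[ζ₄]`. [folklore] -/
theorem norm_alphaInt : Algebra.norm ℤ (alphaInt a b) = ((a ^ 2 + b ^ 2 : ℕ) : ℤ) := by
  have h : ((Algebra.norm ℤ (alphaInt a b) : ℤ) : ℚ) = ((a ^ 2 + b ^ 2 : ℕ) : ℤ) := by
    rw [Algebra.coe_norm_int]
    apply (algebraMap ℚ K4).injective
    rw [algebraMap_norm_K4, show ((alphaInt a b : 𝓞 K4) : K4) = alphaK a b from coe_alphaInt a b,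
      conjK4_alphaK, alphaK_mul_alphaBar]
    simp
  exact_mod_cast h

variable {a b}

/-- `αInt ≠ 0`. [folklore] -/
theorem alphaInt_ne_zero (h : a ^ 2 + b ^ 2 ≠ 0) : alphaInt a b ≠ 0 := by
  intro h0
  apply alphaK_ne_zero h
  rw [← coe_alphaInt, h0]
  rfl

/-- For `p = a² + b²` prime, the principal ideal `(a + bζ₄)` of `ℤ[ζ₄]` is prime (its norm is `p`). [folklore] -/
theorem isPrime_span_alphaInt (hp : (a ^ 2 + b ^ 2).Prime) : (Ideal.span {alphaInt a b}).IsPrime := by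
  apply Ideal.isPrime_of_irreducible_absNorm
  rw [Ideal.absNorm_span_singleton, norm_alphaInt, Int.natAbs_natCast]
  exact hp

/-- **The place `v = (a + bζ₄)` of `ℚ(ζ₄)`** (a prime of `ℤ[ζ₄]` of norm `p = a² + b²`). [folklore] -/
def primeV (hp : (a ^ 2 + b ^ 2).Prime) : HeightOneSpectrum (𝓞 K4) :=
  ⟨Ideal.span {alphaInt a b}, isPrime_span_alphaInt hp, by
    rw [Ne, Ideal.span_singleton_eq_bot]; exact alphaInt_ne_zero hp.ne_zero⟩

end Integers

/-! ## 4a. The presented point -/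

section PointDef

variable (a b : ℕ)

/-- **The point `P_{a,b} = (ℚ(ζ₄), λ_{a,b})`** of the `λ`-line, presented over `ℚ(ζ₄)`. [folklore] -/
def gaussPoint : NFPoint := @NFPoint.mk K4 _ _ (lam a b)

/-- The presenting field of `P_{a,b}` is `ℚ(ζ₄)` (by construction). [folklore] -/
theorem gaussPoint_F : (gaussPoint a b).F = K4 := rfl

/-- The coordinate of `P_{a,b}` is `λ_{a,b}` (by construction). [folklore] -/
theorem gaussPoint_x : (gaussPoint a b).x = lam a b := rfl

end PointDef

end Summit.ABC.IUTFork.Joshi.ATS4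

end
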